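import Mathlib
import Summits.Ventures.PercRepro2.K5HyperDigits
import Summits.Ventures.PercRepro2.K5HyperB25Defs

/-!
# THE `K₅` CERTIFICATE MACHINERY IN BASE `2^25`
(blind cell PercRepro2, typer-1 g10; for the crux kernel's `TvT-TRI` certificates)

`TvT-TRI` compares sums of `30 × 10 = 300` masked triple counts per side, whose crude bound `300 · 3^10 ≈ 17.7 M`
exceeds the base `2^23` of `K5Hyper.lean` — the digit argument needs the coefficients below the base.  This file
is `K5HyperKron.lean` / `K5HyperDigits.lean` in base `KB5 = 2^25` (mask bit `24`; the definitions `go3b5`, `kron35`,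
`mask5`, `CertLE5` are `K5HyperB25Defs.lean`): the identities `kron35_eq` / `kron35_mul_mul` and the digit
argument `le_of_certLE5`.
-/

namespace Summit.Ventures.PercRepro2

open Hub

namespace K5

/-- `go3b5` is the generic tree with base `KB5`, weights `4^e` and the bit-read leaves. -/
lemma go3b5_eq_goGen (B : ℕ) (S : Fin 10 → Bool) :
    ∀ (n : ℕ) (ω : Fin 10 → Bool),
      go3b5 B S n ω = goGen (fun s => (B.testBit (idx2 (orOn S s))).toNat) KB5 (fun e => 4 ^ e) n ω
  | 0, ω => rfl
  | n + 1, ω => by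
    rw [go3b5, goGen, go3b5_eq_goGen B S n, go3b5_eq_goGen B S n]

/-- The Kronecker sum in base `KB5` of a table. -/
def kronSum35 (T : (Fin 10 → Bool) → Bool) : ℕ := ∑ ω, (T ω).toNat * KB5 ^ idx ω

/-- **The masked Kronecker number is the Kronecker sum of the masked table**:
`kron35 T S = Σ_ω [T (ω ∨ S)] · KB5^{idx ω}`. -/
theorem kron35_eq (T : (Fin 10 → Bool) → Bool) (S : Fin 10 → Bool) :
    kron35 T S = kronSum35 (fun ω => T (orOn S ω)) := by
  unfold kron35 kronSum35
  rw [go3b5_eq_goGen, goGen_ten]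
  refine Finset.sum_congr rfl fun s _ => ?_
  rw [testBit_bits]
  rfl

set_option maxRecDepth 10000 in
set_option linter.constructorNameAsVariable false in
/-- A product of three Kronecker sums in base `KB5` as a triple sum. -/
lemma kronSum35_mul_mul_eq_sum (T₁ T₂ T₃ : (Fin 10 → Bool) → Bool) :
    kronSum35 T₁ * kronSum35 T₂ * kronSum35 T₃ =
      ∑ t : (Fin 10 → Bool) × (Fin 10 → Bool) × (Fin 10 → Bool),
        (T₁ t.1).toNat * (T₂ t.2.1).toNat * (T₃ t.2.2).toNat * KB5 ^ idx4 (prof t.1 t.2.1 t.2.2) := by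
  unfold kronSum35
  rw [sum_mul_sum_mul_sum_nat]
  simp only [Fintype.sum_prod_type]
  refine Finset.sum_congr rfl fun a _ => Finset.sum_congr rfl fun b _ =>
    Finset.sum_congr rfl fun c _ => ?_
  rw [idx4_prof, pow_add, pow_add]
  ring

set_option maxRecDepth 10000 in
set_option linter.constructorNameAsVariable false in
/-- **Kronecker substitution in base `KB5`**: a product of three Kronecker sums is the encoding of the
triple counts. -/
theorem kronSum35_mul_mul (T₁ T₂ T₃ : (Fin 10 → Bool) → Bool) :
    kronSum35 T₁ * kronSum35 T₂ * kronSum35 T₃ = ∑ k, cnt3 T₁ T₂ T₃ k * KB5 ^ idx4 k := by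
  rw [kronSum35_mul_mul_eq_sum]
  unfold cnt3
  simp only [Finset.sum_mul]
  rw [← Finset.sum_fiberwise Finset.univ
    (fun t : (Fin 10 → Bool) × (Fin 10 → Bool) × (Fin 10 → Bool) => prof t.1 t.2.1 t.2.2)]
  refine Finset.sum_congr rfl fun k _ => Finset.sum_congr rfl fun t ht => ?_
  rw [Finset.mem_filter] at ht
  rw [ht.2]

/-- **A product of three masked Kronecker numbers is the encoding of the masked triple counts.** -/
theorem kron35_mul_mul (T₁ T₂ T₃ : (Fin 10 → Bool) → Bool) (S₁ S₂ S₃ : Fin 10 → Bool) :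
    kron35 T₁ S₁ * kron35 T₂ S₂ * kron35 T₃ S₃ =
      ∑ k, cnt3 (fun ω => T₁ (orOn S₁ ω)) (fun ω => T₂ (orOn S₂ ω)) (fun ω => T₃ (orOn S₃ ω)) k *
        KB5 ^ idx4 k := by
  rw [kron35_eq, kron35_eq, kron35_eq, kronSum35_mul_mul]


/-- `KB5 = 2^25`. -/
lemma KB5_eq : KB5 = 2 ^ 25 := rfl

/-- `KB5^j = 2^(25 j)`. -/
lemma KB5_pow (j : ℕ) : KB5 ^ j = 2 ^ (25 * j) := by
  rw [KB5_eq, ← pow_mul]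

/-- The scaled geometric sum, for any length `m`. -/
lemma scaled_geomSum5 (m : ℕ) :
    2 ^ 24 * ((KB5 ^ m - 1) / (KB5 - 1)) = ∑ j ∈ Finset.range m, 2 ^ 24 * KB5 ^ j := by
  rw [← Nat.geomSum_eq (by rw [KB5_eq]; norm_num) m]
  exact Finset.mul_sum _ _ _

/-- The mask is `Σ_{j < 4^10} 2^24 · KB5^j`. -/
lemma mask5_eq : mask5 = ∑ j ∈ Finset.range (4 ^ 10), 2 ^ 24 * KB5 ^ j := scaled_geomSum5 (4 ^ 10)

/-- Every base-`KB5` digit of the mask is `2^24`. -/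
lemma mask5_digit {j : ℕ} (hj : j < 4 ^ 10) : mask5 / KB5 ^ j % KB5 = 2 ^ 24 := by
  rw [mask5_eq]
  exact digit_sum (B := KB5) (by rw [KB5_eq]; norm_num) (fun _ => 2 ^ 24) (4 ^ 10)
    (fun _ _ => by rw [KB5_eq]; norm_num) j hj

/-- Bit `24` of the base-`KB5` digit `j` of `X` is the bit `25 j + 22` of `X`. -/
lemma testBit_digit5 (X j : ℕ) :
    X.testBit (25 * j + 24) = decide ((X / KB5 ^ j % KB5) / 2 ^ 24 = 1) := by
  rw [Nat.testBit_eq_decide_div_mod_eq, KB5_pow, KB5_eq]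
  congr 1
  have h1 : X / 2 ^ (25 * j + 24) = X / 2 ^ (25 * j) / 2 ^ 24 := by
    rw [Nat.div_div_eq_div_mul, ← pow_add]
  have h2 : X / 2 ^ (25 * j) % 2 ^ 25 / 2 ^ 24 = X / 2 ^ (25 * j) / 2 ^ 24 % 2 := by
    rw [show (2 : ℕ) ^ 25 = 2 ^ 24 * 2 from by norm_num, Nat.mod_mul_right_div_self]
  rw [h1, h2]

/-- Bit `25 j + 22` of the mask is set for `j < 4^10`. -/
lemma mask5_testBit {j : ℕ} (hj : j < 4 ^ 10) : mask5.testBit (25 * j + 24) = true := by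
  rw [testBit_digit5, mask5_digit hj, Nat.div_self (by norm_num), decide_eq_true_iff]

/-- **The mask test bounds the digits**: `Nat.land X mask5 = 0` forces every base-`KB5` digit of `X`
below `2^24`. -/
theorem digit_lt_of_land_mask5 {X : ℕ} (h : Nat.land X mask5 = 0) {j : ℕ} (hj : j < 4 ^ 10) :
    X / KB5 ^ j % KB5 < 2 ^ 24 := by
  have hbit : X.testBit (25 * j + 24) = false := by
    change X &&& mask5 = 0 at h
    have := congrArg (fun n => n.testBit (25 * j + 24)) h
    simp only [Nat.testBit_land, Nat.zero_testBit] at this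
    rwa [mask5_testBit hj, Bool.and_true] at this
  rw [testBit_digit5, decide_eq_false_iff_not] at hbit
  have hlt : X / KB5 ^ j % KB5 < KB5 := Nat.mod_lt _ (by rw [KB5_eq]; norm_num)
  rw [KB5_eq] at hlt
  have hq : X / KB5 ^ j % KB5 / 2 ^ 24 < 2 := by
    rw [Nat.div_lt_iff_lt_mul (by norm_num)]
    calc X / KB5 ^ j % KB5 < 2 ^ 25 := hlt
      _ = 2 * 2 ^ 24 := by norm_num
  have hq0 : X / KB5 ^ j % KB5 / 2 ^ 24 = 0 := by omega
  rwa [Nat.div_eq_zero_iff_lt (by norm_num)] at hq0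


/-- A sum over the profiles re-indexed over `range (4^10)` through `decode4`. -/
lemma sum_profiles_eq5 (c : (Fin 10 → Fin 4) → ℕ) :
    ∑ k, c k * KB5 ^ idx4 k = ∑ j ∈ Finset.range (4 ^ 10), c (decode4 j) * KB5 ^ j := by
  refine Finset.sum_nbij' idx4 decode4 (fun k _ => ?_) (fun j _ => Finset.mem_univ _)
    (fun k _ => decode4_idx4 k) (fun j hj => ?_) (fun k _ => ?_)
  · exact Finset.mem_range.2 (idx4_lt k)
  · exact idx4_decode4 (Finset.mem_range.1 hj)
  · rw [decode4_idx4]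

/-- **The digit argument in base `KB5`** with the third mask test: if `P = Σ_k a k KB5^{idx4 k}`,
`M = Σ_k b k KB5^{idx4 k}` with `a, b < KB5`, `M ≤ P`, `Nat.land (P − M) mask5 = 0` and
`Nat.land M mask5 = 0`, then `b k ≤ a k` for every profile `k`. -/
theorem le_of_kron_le5 (a b : (Fin 10 → Fin 4) → ℕ) (ha : ∀ k, a k < KB5) (hb : ∀ k, b k < KB5)
    {P M : ℕ} (hP : P = ∑ k, a k * KB5 ^ idx4 k) (hM : M = ∑ k, b k * KB5 ^ idx4 k) (hle : M ≤ P)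
    (hmask : Nat.land (P - M) mask5 = 0) (hmaskM : Nat.land M mask5 = 0) (k : Fin 10 → Fin 4) :
    b k ≤ a k := by
  have hKB : 2 ≤ KB5 := by rw [KB5_eq]; norm_num
  have hb' : ∀ k, b k < 2 ^ 24 := by
    intro k
    have hj : idx4 k < 4 ^ 10 := idx4_lt k
    have h1 : M / KB5 ^ idx4 k % KB5 = b k := by
      rw [hM, sum_profiles_eq5]
      rw [digit_sum hKB (fun j => b (decode4 j)) (4 ^ 10) (fun j _ => hb _) (idx4 k) hj, decode4_idx4]
    rw [← h1]
    exact digit_lt_of_land_mask5 hmaskM hj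
  set D := P - M with hD
  have hDM : P = D + M := by omega
  have hdlt : ∀ j < 4 ^ 10, D / KB5 ^ j % KB5 < 2 ^ 24 := fun j hj => digit_lt_of_land_mask5 hmask hj
  have hPlt : P < KB5 ^ (4 ^ 10) := by
    rw [hP, sum_profiles_eq5]
    exact sum_lt_pow hKB _ _ fun j _ => ha _
  have hDlt : D < KB5 ^ (4 ^ 10) := by omega
  have hDsum := expand_digits hKB (4 ^ 10) D hDlt
  have hPsum : P = ∑ j ∈ Finset.range (4 ^ 10), (D / KB5 ^ j % KB5 + b (decode4 j)) * KB5 ^ j := by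
    rw [hDM, hM, sum_profiles_eq5]
    conv_lhs => rw [hDsum]
    rw [← Finset.sum_add_distrib]
    exact Finset.sum_congr rfl fun j _ => by ring
  have hj : idx4 k < 4 ^ 10 := idx4_lt k
  have h1 : P / KB5 ^ idx4 k % KB5 = a k := by
    rw [hP, sum_profiles_eq5]
    rw [digit_sum hKB (fun j => a (decode4 j)) (4 ^ 10) (fun j _ => ha _) (idx4 k) hj, decode4_idx4]
  have h2 : P / KB5 ^ idx4 k % KB5 = D / KB5 ^ idx4 k % KB5 + b k := by
    rw [hPsum]
    rw [digit_sum hKB (fun j => D / KB5 ^ j % KB5 + b (decode4 j)) (4 ^ 10)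
      (fun j hj' => by
        have := hdlt j hj'; have := hb' (decode4 j)
        have h2 : (2 : ℕ) ^ 24 + 2 ^ 24 = KB5 := by rw [KB5_eq]; norm_num
        omega) (idx4 k) hj,
      decode4_idx4]
  have e : a k = D / KB5 ^ idx4 k % KB5 + b k := h1.symm.trans h2
  rw [e]
  exact Nat.le_add_left _ _

/-- **A certificate `CertLE5 M P` gives the coefficient inequality** when `P`, `M` encode coefficients
below `KB5`. -/
theorem le_of_certLE5 (a b : (Fin 10 → Fin 4) → ℕ) (ha : ∀ k, a k < KB5) (hb : ∀ k, b k < KB5)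
    {P M : ℕ} (hP : P = ∑ k, a k * KB5 ^ idx4 k) (hM : M = ∑ k, b k * KB5 ^ idx4 k)
    (hc : CertLE5 M P) (k : Fin 10 → Fin 4) : b k ≤ a k :=
  le_of_kron_le5 a b ha hb hP hM hc.1 hc.2.1 hc.2.2 k

/-- Two encodings add (coefficient functions abstract). -/
lemma sum_add_mulB5 (f g : (Fin 10 → Fin 4) → ℕ) :
    ∑ k, f k * KB5 ^ idx4 k + ∑ k, g k * KB5 ^ idx4 k = ∑ k, (f k + g k) * KB5 ^ idx4 k := by
  rw [← Finset.sum_add_distrib]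
  exact Finset.sum_congr rfl fun k _ => (add_mul _ _ _).symm


end K5

end Summit.Ventures.PercRepro2
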